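import Summits.HubbardSuperconductivity.HubbardSuperconductivity.Theorems.BirComplexStableXY.Negative.WitnessTable
import Summits.HubbardSuperconductivity.HubbardSuperconductivity.Theorems.BalabanIRBirComplexStableXYFixedVolumeAction
import Literature.MathematicalPhysics.QuantumFieldTheory.TorusChartSpinWaveGauge
import HarnessLib

/-!
# Route `BalabanIR`, crux 2R `BirComplexStableXYR` (stmt-HubbardSuperconductivity-14845): the spin-wave sector of
# the engine's partition function as a sum over winding sectors of real-field integrals

Helper (`--supports`) for the T-RG definition layer D1′ (item 2, "the lift": vortex-free angle configurations ↦
real fields + windings; lead c6 `Cruxes/BirComplexStableXYR/NOTES.md`, evidence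
`Prover1_14845_s35_TRG_definition_layer.md` §3).  Instantiates the generic spin-wave package
`Literature.MathematicalPhysics.QuantumFieldTheory.TorusChart*` on the engine's torus
`Λ L M = TorusSite 2 L × ZMod M` with its space–time chart `TorusChart.piProdZMod 2 L M`
(directions `0, 1` spatial of period `L`, direction `2` temporal of period `M`); no definitions:

* `partZ_eq_spinWave_add_vortex`: `Z = Z_sw + Z_vx`, the engine's `partZ K c L M` split into the integral of
  `e^{-A}` over the VORTEX-FREE configurations of the cube (all plaquette vorticities of `θ mod 2π` vanish)
  and over the configurations with at least one vortex;
* `spinWave_eq_tsum` (**registered stub `birSpinWave_partZsw_eq_tsum`**): the spin-wave sector is the sum over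
  winding sectors `k ∈ ℤ³` of the integrals of `e^{-A(φ)}` over the lift domains
  `liftDom k = {φ : Λ → ℝ | φ 0 ∈ [0,2π), d₀ φ + seam (2π k) ∈ (-π, π] edgewise}` — real fields whose
  seam-corrected nearest-neighbour gradients ARE the reduced phase gradients, the starting point of every
  Gaussian / multiscale treatment of the low-temperature phase (T-RG).

Inputs: `2π`-periodicity and continuity of the window action (`birAct_action_periodic`,
`birAct_continuous_action`, landed for crux 2) and the generic identity
`TorusChart.setIntegral_cubeIcc_vortexFree_eq_tsum`.
-/

set_option linter.dupNamespace false -- summit = problem name (single-conjunct summit), D-0017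

namespace Summit.HubbardSuperconductivity.HubbardSuperconductivity.Theorems

open scoped BigOperators
open MeasureTheory Literature.Probability.LatticeModels Literature.MathematicalPhysics.QuantumFieldTheory
open Summit.HubbardSuperconductivity.BirComplexStableXYNegative

variable {r : ℕ}

/-- The engine's cube `[0,2π]^Λ` is the closed cube of the spin-wave package. -/
theorem cube_eq_cubeIcc (L M : ℕ) : cube L M = TorusChart.cubeIcc (Λ L M) := rfl

/-- **The Gibbs factor is `2π`-periodic in every angle.** -/
theorem cexp_neg_action_add_zsmul (K : ℝ) (c : Table r) (L M : ℕ) [NeZero L] [NeZero M] (n : Λ L M → ℤ)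
    (θ : Λ L M → ℝ) :
    Complex.exp (-(action K c L M (fun x => θ x + n x • (2 * Real.pi)))) = Complex.exp (-(action K c L M θ)) := by
  have h := birAct_action_periodic c (F := genF c) (fun φ => rfl) (sh L M) θ n
  simp only [action]
  rw [h]

/-- **The Gibbs factor is integrable on the cube** (continuous on a compact set). -/
theorem integrableOn_cexp_neg_action (K : ℝ) (c : Table r) (L M : ℕ) [NeZero L] [NeZero M] :
    IntegrableOn (fun θ : Λ L M → ℝ => Complex.exp (-(action K c L M θ))) (cube L M) := by
  have hcont : Continuous fun θ : Λ L M → ℝ => Complex.exp (-(action K c L M θ)) := by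
    have h := birAct_continuous_action c (F := genF c) (fun φ => rfl) (sh L M)
    simp only [action]
    exact Complex.continuous_exp.comp ((continuous_const.mul h).neg)
  have hcpt : IsCompact (cube L M) := isCompact_univ_pi fun _ => isCompact_Icc
  exact hcont.continuousOn.integrableOn_compact hcpt

/-- **`Z = Z_sw + Z_vx`**: the engine's partition function splits into its SPIN-WAVE sector (the integral of the
Gibbs factor over the vortex-free configurations of the cube: all plaquette vorticities of `θ mod 2π` in the
space–time chart `TorusChart.piProdZMod 2 L M` vanish) and its VORTEX sector (at least one non-zero plaquette
vorticity). -/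
theorem partZ_eq_spinWave_add_vortex (K : ℝ) (c : Table r) (L M : ℕ) [NeZero L] [NeZero M] :
    partZ K c L M =
      (∫ θ in cube L M ∩ (TorusChart.piProdZMod 2 L M).vortexFreeSet, Complex.exp (-(action K c L M θ))) +
        ∫ θ in cube L M ∩ ((TorusChart.piProdZMod 2 L M).vortexFreeSet)ᶜ, Complex.exp (-(action K c L M θ)) := by
  have hV : MeasurableSet (TorusChart.piProdZMod 2 L M).vortexFreeSet :=
    (TorusChart.piProdZMod 2 L M).measurableSet_vortexFreeSet
  have hi := integrableOn_cexp_neg_action K c L M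
  rw [partZ, ← integral_inter_add_sdiff hV hi, Set.sdiff_eq]

/-- **The spin-wave sector as a sum over winding sectors of real-field integrals**:
`Z_sw = Σ_{k ∈ ℤ³} ∫_{liftDom k} e^{-A(φ)} dφ`, where `liftDom k` consists of the real fields `φ` on the torus
with `φ 0 ∈ [0, 2π)` all of whose seam-corrected gradients `d₀ φ + seam (2π k)` lie in `(-π, π]`. -/
theorem spinWave_eq_tsum (K : ℝ) (c : Table r) (L M : ℕ) [NeZero L] [NeZero M] :
    (∫ θ in cube L M ∩ (TorusChart.piProdZMod 2 L M).vortexFreeSet, Complex.exp (-(action K c L M θ))) =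
      ∑' k : Fin 3 → ℤ, ∫ φ in (TorusChart.piProdZMod 2 L M).liftDom k, Complex.exp (-(action K c L M φ)) := by
  rw [cube_eq_cubeIcc]
  exact (TorusChart.piProdZMod 2 L M).setIntegral_cubeIcc_vortexFree_eq_tsum _
    (cexp_neg_action_add_zsmul K c L M)
    (by rw [← cube_eq_cubeIcc]; exact integrableOn_cexp_neg_action K c L M)

/-- **Registered stub `birSpinWave_partZsw_eq_tsum`** of stmt-HubbardSuperconductivity-14845 (D1′ item 2, the
lift): the engine's partition function is the sum over winding sectors `k ∈ ℤ³` of the real-field integrals of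
the Gibbs factor over the lift domains of the space–time chart, plus the vortex sector. -/
theorem birSpinWave_partZsw_eq_tsum : ∀ (r : ℕ) (K : ℝ) (c : Table r) (L M : ℕ) [NeZero L] [NeZero M], partZ K c L M = (∑' k : Fin 3 → ℤ, ∫ φ in (Literature.MathematicalPhysics.QuantumFieldTheory.TorusChart.piProdZMod 2 L M).liftDom k, Complex.exp (-(action K c L M φ))) + ∫ θ in cube L M ∩ ((Literature.MathematicalPhysics.QuantumFieldTheory.TorusChart.piProdZMod 2 L M).vortexFreeSet)ᶜ, Complex.exp (-(action K c L M θ)) := by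
  intro r K c L M _ _
  rw [partZ_eq_spinWave_add_vortex, spinWave_eq_tsum]

/-! ## Gauge fixing of the global rotation (appended, prover seat 1 s37) -/

/-- **Under (U1) the Gibbs factor is invariant under the global rotation** `θ ↦ θ + α`. -/
theorem cexp_neg_action_add_const (K : ℝ) (c : Table r) (hU1 : ∀ n ∈ c.support, ∑ w, n w = 0) (L M : ℕ)
    [NeZero L] [NeZero M] (θ : Λ L M → ℝ) (α : ℝ) :
    Complex.exp (-(action K c L M (fun x => θ x + α))) = Complex.exp (-(action K c L M θ)) := by
  have h := birAct_action_rotate c hU1 (F := genF c) (fun φ => rfl) (sh L M) θ α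
  simp only [action]
  rw [h]

/-- **The zero mode of each winding sector integrates out to `2π`** (under (U1)): the real-field integral of
the Gibbs factor over the lift domain `liftDom k` of the space–time chart is `2π` times the integral over the
fields PINNED AT THE ORIGIN (`extZero ψ`, `ψ : Λ∖0 → ℝ`) whose seam-corrected gradients are principal values
(`gradDom k`). Registered stub `birSpinWave_liftDom_eq_smul` of stmt-HubbardSuperconductivity-14845. -/
theorem birSpinWave_liftDom_eq_smul : ∀ (r : ℕ) (K : ℝ) (c : Table r), (∀ n ∈ c.support, ∑ w, n w = 0) → ∀ (L M : ℕ) [NeZero L] [NeZero M] (k : Fin 3 → ℤ), (∫ φ in (Literature.MathematicalPhysics.QuantumFieldTheory.TorusChart.piProdZMod 2 L M).liftDom k, Complex.exp (-(action K c L M φ))) = (2 * Real.pi) • ∫ ψ in {ψ : Literature.MathematicalPhysics.QuantumFieldTheory.TorusChart.Punctured (Λ L M) → ℝ | Literature.MathematicalPhysics.QuantumFieldTheory.TorusChart.extZero ψ ∈ (Literature.MathematicalPhysics.QuantumFieldTheory.TorusChart.piProdZMod 2 L M).gradDom k}, Complex.exp (-(action K c L M (Literature.MathematicalPhysics.QuantumFieldTheory.TorusChart.extZero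 ψ))) := by
  intro r K c hU1 L M _ _ k
  exact (TorusChart.piProdZMod 2 L M).setIntegral_liftDom_eq_smul k _ (cexp_neg_action_add_const K c hU1 L M)

end Summit.HubbardSuperconductivity.HubbardSuperconductivity.Theorems
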